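import Mathlib

/-!
# AtomicCalibrationR (stmt-QuantumFields-28169), E2 `stub_offDiagonalWhitney` — roadmap v3 item G.1 (first half):
# an explicit GEVREY-2 bound for Mathlib's `expNegInvGlue` (`x ↦ e^{−1/x}` glued to `0`)

Roadmap v3 addendum (prover w4 g22, evidence on ⟨stmt-QuantumFields-28169⟩) item G.1 asks for ONE explicit smooth profile/step
whose derivatives of ALL orders obey `‖D^j‖ ≤ C₀ C₁^j (j!)^s` with constants independent of `j` (the compactness-based bounds of
`PairCutoffDeriv.exists_bound_iteratedFDeriv_step` / `BandBump.exists_profile_deriv_bounds` depend on the derivative budget).  This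
file proves the analytic input:

* `norm_iteratedDeriv_expNegInvGlue_le` / `norm_iteratedFDeriv_expNegInvGlue_le` —
  `‖expNegInvGlue^{(j)}(x)‖ ≤ 9^j (j!)^2` for every `j : ℕ` and every `x : ℝ`;
* `norm_iteratedFDeriv_expNegInvGlue_one_sub_le` — the same for `x ↦ expNegInvGlue (1 − x)`.

Proof: for `x > 0`, `expNegInvGlue` agrees near `x` with the real trace of the holomorphic `F(z) = exp(−1/z)`; on the circle
`|z − x| = x/2` one has `Re(1/z) = Re z/|z|² ≥ (x/2)/(3x/2)² = 2/(9x)`, so `|F| ≤ e^{−2/(9x)}` there, and Cauchy's estimate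
(`Complex.norm_iteratedDeriv_le_of_forall_mem_sphere_norm_le`) gives `|F^{(j)}(x)| ≤ j!·e^{−2/(9x)}·(2/x)^j ≤ j!·j!·9^j`
(`u^j ≤ j!·e^u` with `u = 2/(9x)`, `Real.pow_div_factorial_le_exp`); real ↔ complex derivatives by `HasDerivAt.real_of_complex`;
`x < 0` by local vanishing, `x = 0` by continuity of `expNegInvGlue^{(j)}` and density of `{x ≠ 0}`.

Mathlib only.  No stub/crux/rung/summit is closed; nothing here touches Yang–Mills; the YM mass gap is NOT proved. [folklore]
-/

set_option autoImplicit false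

noncomputable section

open scoped ContDiff Topology
open Set Metric Filter

namespace Summit.QuantumFields.YangMills.Cruxes.AtomicCalibrationR.GevreyExpNegInvGlue

/-! ### (A) Cauchy estimates for `z ↦ exp (−1/z)` and the Gevrey-2 bound for `expNegInvGlue` -/

/-- `F(z) = exp(−1/z)` is complex differentiable away from `0`. -/
theorem differentiableOn_F : DifferentiableOn ℂ (fun z : ℂ => Complex.exp (-z⁻¹)) {z : ℂ | z ≠ 0} := by
  intro z hz
  have h : DifferentiableAt ℂ (fun w : ℂ => -w⁻¹) z := (differentiableAt_inv_iff.mpr hz).neg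
  exact h.cexp.differentiableWithinAt

/-- All iterated derivatives of `F(z) = exp(−1/z)` are complex differentiable away from `0`. -/
theorem differentiableOn_iteratedDeriv_F (k : ℕ) :
    DifferentiableOn ℂ (iteratedDeriv k (fun z : ℂ => Complex.exp (-z⁻¹))) {z : ℂ | z ≠ 0} := by
  induction k with
  | zero => simpa using differentiableOn_F
  | succ k ih =>
    rw [iteratedDeriv_succ]
    exact ih.deriv isOpen_ne

/-- Along the real axis and away from `0`, `Re F^{(k)}` has derivative `Re F^{(k+1)}` (`F(z) = exp(−1/z)`). -/
theorem hasDerivAt_re_iteratedDeriv_F (k : ℕ) {x : ℝ} (hx : x ≠ 0) :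
    HasDerivAt (fun y : ℝ => (iteratedDeriv k (fun z : ℂ => Complex.exp (-z⁻¹)) y).re)
      (iteratedDeriv (k + 1) (fun z : ℂ => Complex.exp (-z⁻¹)) x).re x := by
  have hx' : (x : ℂ) ∈ {z : ℂ | z ≠ 0} := by simpa using hx
  have hd : DifferentiableAt ℂ (iteratedDeriv k (fun z : ℂ => Complex.exp (-z⁻¹))) (x : ℂ) :=
    (differentiableOn_iteratedDeriv_F k).differentiableAt (isOpen_ne.mem_nhds hx')
  rw [iteratedDeriv_succ]
  exact hd.hasDerivAt.real_of_complex

/-- Away from `0`, the real iterated derivatives of `y ↦ Re exp(−1/y)` are the real parts of the complex ones of `F(z) = exp(−1/z)`. -/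
theorem iteratedDeriv_fR_eqOn (k : ℕ) :
    Set.EqOn (iteratedDeriv k (fun y : ℝ => (Complex.exp (-(y : ℂ)⁻¹)).re))
      (fun y : ℝ => (iteratedDeriv k (fun z : ℂ => Complex.exp (-z⁻¹)) y).re) {y : ℝ | y ≠ 0} := by
  induction k with
  | zero => intro y _; simp
  | succ k ih =>
    intro y hy
    have h1 : iteratedDeriv k (fun y : ℝ => (Complex.exp (-(y : ℂ)⁻¹)).re) =ᶠ[𝓝 y]
        fun t : ℝ => (iteratedDeriv k (fun z : ℂ => Complex.exp (-z⁻¹)) t).re :=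
      Filter.eventuallyEq_of_mem (isOpen_ne.mem_nhds hy) ih
    rw [iteratedDeriv_succ, h1.deriv_eq]
    exact (hasDerivAt_re_iteratedDeriv_F k hy).deriv

/-- Near a positive point, `expNegInvGlue` agrees with `y ↦ Re exp(−1/y)`. -/
theorem expNegInvGlue_eventuallyEq_fR {x : ℝ} (hx : 0 < x) :
    expNegInvGlue =ᶠ[𝓝 x] (fun y : ℝ => (Complex.exp (-(y : ℂ)⁻¹)).re) := by
  filter_upwards [Ioi_mem_nhds hx] with y hy
  rw [expNegInvGlue, if_neg (not_le.mpr hy)]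
  show Real.exp (-y⁻¹) = (Complex.exp (-(y : ℂ)⁻¹)).re
  have : -((y : ℂ)⁻¹) = ((-y⁻¹ : ℝ) : ℂ) := by push_cast; ring
  rw [this, Complex.exp_ofReal_re]

/-- For `x > 0`: `expNegInvGlue^{(k)}(x) = Re F^{(k)}(x)` with `F(z) = exp(−1/z)`. -/
theorem iteratedDeriv_expNegInvGlue_eq {x : ℝ} (hx : 0 < x) (k : ℕ) :
    iteratedDeriv k expNegInvGlue x = (iteratedDeriv k (fun z : ℂ => Complex.exp (-z⁻¹)) x).re := by
  rw [(expNegInvGlue_eventuallyEq_fR hx).iteratedDeriv_eq k]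
  exact iteratedDeriv_fR_eqOn k hx.ne'

/-- On the circle `|z − x| = x/2` (`x > 0`): `|exp(−1/z)| ≤ exp (−2/(9x))`. -/
theorem norm_F_le {x : ℝ} (hx : 0 < x) {z : ℂ} (hz : z ∈ sphere (x : ℂ) (x / 2)) :
    ‖Complex.exp (-z⁻¹)‖ ≤ Real.exp (-(2 / (9 * x))) := by
  rw [Complex.norm_exp, Real.exp_le_exp, Complex.neg_re, Complex.inv_re, Complex.normSq_eq_norm_sq,
    neg_le_neg_iff]
  have hzx : ‖z - x‖ = x / 2 := by rwa [mem_sphere_iff_norm] at hz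
  have hre : x / 2 ≤ z.re := by
    have h1 : |(z - x).re| ≤ ‖z - (x : ℂ)‖ := Complex.abs_re_le_norm (z - x)
    have h2 : (z - (x : ℂ)).re = z.re - x := by simp
    rw [h2, hzx] at h1
    have := (abs_le.mp h1).1
    linarith
  have hnorm : ‖z‖ ≤ 3 * x / 2 := by
    calc ‖z‖ = ‖(z - x) + (x : ℂ)‖ := by rw [sub_add_cancel]
      _ ≤ ‖z - (x : ℂ)‖ + ‖(x : ℂ)‖ := norm_add_le _ _
      _ = x / 2 + x := by rw [hzx]; simp [abs_of_pos hx]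
      _ = 3 * x / 2 := by ring
  have hzpos : 0 < ‖z‖ := by
    have h0 : 0 < z.re := by linarith
    refine norm_pos_iff.mpr fun h => ?_
    rw [h] at h0
    simp at h0
  calc 2 / (9 * x) = (x / 2) / (3 * x / 2) ^ 2 := by field_simp; ring
    _ ≤ (x / 2) / ‖z‖ ^ 2 := by
        refine div_le_div_of_nonneg_left (by positivity) (by positivity) ?_
        exact pow_le_pow_left₀ (norm_nonneg _) hnorm 2
    _ ≤ z.re / ‖z‖ ^ 2 := div_le_div_of_nonneg_right hre (by positivity)

/-- **Cauchy estimate**: `|F^{(j)}(x)| ≤ j! · exp (−2/(9x)) / (x/2)^j` for `x > 0` (`F(z) = exp(−1/z)`). -/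
theorem norm_iteratedDeriv_F_le {x : ℝ} (hx : 0 < x) (j : ℕ) :
    ‖iteratedDeriv j (fun z : ℂ => Complex.exp (-z⁻¹)) x‖ ≤ j.factorial * Real.exp (-(2 / (9 * x))) / (x / 2) ^ j := by
  have hR : 0 < x / 2 := by positivity
  refine Complex.norm_iteratedDeriv_le_of_forall_mem_sphere_norm_le j hR ?_ fun z hz => norm_F_le hx hz
  refine (differentiableOn_F.mono ?_).diffContOnCl
  rw [closure_ball _ hR.ne']
  intro z hz h0
  rw [h0, mem_closedBall, dist_comm, dist_zero_right] at hz
  have : ‖(x : ℂ)‖ = x := by simp [abs_of_pos hx]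
  rw [this] at hz
  linarith

/-- The elementary optimisation `j! e^{−2/(9x)} (2/x)^j ≤ 9^j (j!)^2`. -/
theorem key_ineq {x : ℝ} (hx : 0 < x) (j : ℕ) :
    (j.factorial : ℝ) * Real.exp (-(2 / (9 * x))) / (x / 2) ^ j ≤ 9 ^ j * (j.factorial : ℝ) ^ 2 := by
  have hu : 0 < 2 / (9 * x) := by positivity
  have hfac : (0 : ℝ) < j.factorial := by positivity
  have h1 := Real.pow_div_factorial_le_exp _ hu.le j
  rw [div_le_iff₀ hfac] at h1
  have h2 : Real.exp (-(2 / (9 * x))) ≤ j.factorial * (9 * x / 2) ^ j := by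
    rw [Real.exp_neg]
    have h3 : (2 / (9 * x)) ^ j * (9 * x / 2) ^ j = 1 := by
      rw [← mul_pow]
      have : 2 / (9 * x) * (9 * x / 2) = 1 := by field_simp
      rw [this, one_pow]
    have hexp : 0 < Real.exp (2 / (9 * x)) := Real.exp_pos _
    calc (Real.exp (2 / (9 * x)))⁻¹ = (Real.exp (2 / (9 * x)))⁻¹ * ((2 / (9 * x)) ^ j * (9 * x / 2) ^ j) := by
          rw [h3, mul_one]
      _ ≤ (Real.exp (2 / (9 * x)))⁻¹ * ((Real.exp (2 / (9 * x)) * j.factorial) * (9 * x / 2) ^ j) := by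
          gcongr
      _ = j.factorial * (9 * x / 2) ^ j := by field_simp
  have h4 : (9 * x / 2) ^ j = 9 ^ j * (x / 2) ^ j := by rw [← mul_pow]; ring_nf
  have hx2 : (x / 2) ^ j ≠ 0 := by positivity
  calc (j.factorial : ℝ) * Real.exp (-(2 / (9 * x))) / (x / 2) ^ j
      ≤ (j.factorial : ℝ) * (j.factorial * (9 * x / 2) ^ j) / (x / 2) ^ j := by gcongr
    _ = 9 ^ j * (j.factorial : ℝ) ^ 2 := by
        rw [h4]; field_simp

/-- **Gevrey-2 bound for Mathlib's `expNegInvGlue`** (`x ↦ e^{−1/x}` glued to `0`): for every `j` and every real `x`,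
`|expNegInvGlue^{(j)}(x)| ≤ 9^j (j!)^2`. [folklore; Cauchy estimates] -/
theorem norm_iteratedDeriv_expNegInvGlue_le (j : ℕ) (x : ℝ) :
    ‖iteratedDeriv j expNegInvGlue x‖ ≤ 9 ^ j * (j.factorial : ℝ) ^ 2 := by
  have key : ∀ y : ℝ, y ≠ 0 → ‖iteratedDeriv j expNegInvGlue y‖ ≤ 9 ^ j * (j.factorial : ℝ) ^ 2 := by
    intro y hy
    rcases lt_or_gt_of_ne hy with hneg | hpos
    · have h0 : expNegInvGlue =ᶠ[𝓝 y] fun _ => (0 : ℝ) := by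
        filter_upwards [Iio_mem_nhds hneg] with t ht using expNegInvGlue.zero_of_nonpos ht.le
      rw [h0.iteratedDeriv_eq, iteratedDeriv_const]
      split_ifs <;> simp
    · rw [iteratedDeriv_expNegInvGlue_eq hpos, Real.norm_eq_abs]
      calc |(iteratedDeriv j (fun z : ℂ => Complex.exp (-z⁻¹)) y).re|
          ≤ ‖iteratedDeriv j (fun z : ℂ => Complex.exp (-z⁻¹)) y‖ := Complex.abs_re_le_norm _
        _ ≤ _ := norm_iteratedDeriv_F_le hpos j
        _ ≤ _ := key_ineq hpos j
  have hcont : Continuous (iteratedDeriv j expNegInvGlue) :=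
    ContDiff.continuous_iteratedDeriv' j (expNegInvGlue.contDiff (n := j))
  have hclosed : IsClosed {y : ℝ | ‖iteratedDeriv j expNegInvGlue y‖ ≤ 9 ^ j * (j.factorial : ℝ) ^ 2} :=
    isClosed_le (continuous_norm.comp hcont) continuous_const
  have hdense : Dense {y : ℝ | ‖iteratedDeriv j expNegInvGlue y‖ ≤ 9 ^ j * (j.factorial : ℝ) ^ 2} :=
    (dense_compl_singleton (0 : ℝ)).mono fun y hy => key y (by simpa using hy)
  have huniv := hdense.closure_eq
  rw [hclosed.closure_eq] at huniv
  have hx : x ∈ (Set.univ : Set ℝ) := trivial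
  rw [← huniv] at hx
  exact hx

/-- The same bound for the Fréchet-derivative norm, in the «`(j!)^2 · 9^j`» shape. -/
theorem norm_iteratedFDeriv_expNegInvGlue_le (j : ℕ) (x : ℝ) :
    ‖iteratedFDeriv ℝ j expNegInvGlue x‖ ≤ ((Nat.factorial j : ℕ) : ℝ) ^ 2 * 9 ^ j := by
  rw [norm_iteratedFDeriv_eq_norm_iteratedDeriv, mul_comm]
  exact norm_iteratedDeriv_expNegInvGlue_le j x

/-- The reflected factor `y ↦ expNegInvGlue (1 − y)` obeys the same Gevrey-2 bound. -/
theorem norm_iteratedFDeriv_expNegInvGlue_one_sub_le (j : ℕ) (x : ℝ) :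
    ‖iteratedFDeriv ℝ j (fun y : ℝ => expNegInvGlue (1 - y)) x‖ ≤ ((Nat.factorial j : ℕ) : ℝ) ^ 2 * 9 ^ j := by
  rw [norm_iteratedFDeriv_eq_norm_iteratedDeriv, iteratedDeriv_comp_const_sub j expNegInvGlue 1]
  simp only [norm_smul, norm_pow, norm_neg, norm_one, one_pow, one_mul]
  rw [mul_comm]
  exact norm_iteratedDeriv_expNegInvGlue_le j (1 - x)

end Summit.QuantumFields.YangMills.Cruxes.AtomicCalibrationR.GevreyExpNegInvGlue

end
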